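import Mathlib
import HarnessLib
import Summits.ValiantsHypothesis.ValiantsHypothesis.Theorems.LacunarySymmetroidMatrixDescartesProductPlusOneRowTowerKDefs

/-!
# LINE (A) `product_plus_one` — the θ-tower of a K-nomial row: calculus, signs, and the RATE LAWS (every support size)

Companion of ✓ `…RowTowerKDefs` (`rowHK`, `rowUK`, `rowPsiK0…3` for the stripped row `A − Σ_l B_l x^{λ_l}`, rates `λ : Fin n → ℕ`).  Exactly the K = 3 facts of
✓ `…CloudCalculus` / `…CloudMonotone` / `…ThetaShell`, for every `n`:

* §1 `hasDerivAt_rowHK` (`d/dx H_k = H_{k+1}/x`), `hasDerivAt_rowUK` (`d/dx u = H₁u²/x`), `hasDerivAt_rowPsiK1` (`= ψ₂/x`), `hasDerivAt_rowPsiK2` (`= ψ₃/x`);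
* §2 signs: `rowHK_nonneg` (`B ≥ 0`, `x > 0`), `rowUK_pos`, `rowPsiK1_pos` (genuine unswitched incoherent row);
* §3 ★ the CLOUD LAW for every K: if every rate `λ_l ≥ p` (`p : ℕ`), `B ≥ 0`, `x > 0` and the row is unswitched (`0 < A − Σ B_l x^{λ_l}`) then `p²·ψ₁ ≤ ψ₃`
  (`rowPsiK3_sub_sq_mul_rowPsiK1_eq`: `ψ₃ − p²ψ₁ = (H₄ − p²H₂)u + (3H₁H₃ + 3H₂² + H₁(H₃ − p²H₁))u² + 12H₁²H₂u³ + 6H₁⁴u⁴` with `H₄ − p²H₂ = Σ λ_l²(λ_l² − p²)B_l x^{λ_l} ≥ 0`,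
  `H₃ − p²H₁ = Σ λ_l(λ_l² − p²)B_l x^{λ_l} ≥ 0`), strict when some `B_l x^{λ_l} > 0` with `λ_l ≥ 1` (`rowPsiK3_gt`);
* §4 ★ the ONE-LETTER RATE LAW: for `n = 1` (a binomial row of rate `λ`), `ψ₃ − λ²ψ₁ = 6ψ₁²` (`rowPsiK3_one_letter_law`) and the closed form `ψ₁ = λ²·A·(Bx^λ)·u²`.

Honest framing: calculus of rows; nothing closes; `OneChangeFloorK3` / `WronskianBudgetK3` / 18050 / `MatrixDescartes` OPEN; `VP ≠ VNP` NOT proved.  No new definitions here.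
-/

set_option linter.dupNamespace false

namespace Summit.ValiantsHypothesis.ValiantsHypothesis.Theorems.LacunarySymmetroidMatrixDescartes

namespace ProductPlusOne

open Finset
open scoped BigOperators Topology

variable {n : ℕ} (lam : Fin n → ℕ) (A : ℝ) (B : Fin n → ℝ)

/-! ### §1 Derivatives -/

/-- `d/dx H_k = H_{k+1}/x` for `x ≠ 0`. [this file's lemma] -/
theorem hasDerivAt_rowHK (k : ℕ) {x : ℝ} (hx : x ≠ 0) :
    HasDerivAt (rowHK lam k B) (rowHK lam (k + 1) B x / x) x := by
  unfold rowHK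
  rw [Finset.sum_div]
  refine HasDerivAt.fun_sum fun l _ => ?_
  have hp : HasDerivAt (fun t : ℝ => t ^ (lam l)) (((lam l : ℕ) : ℝ) * x ^ (lam l - 1)) x := hasDerivAt_pow (lam l) x
  refine ((hp.const_mul (((lam l : ℕ) : ℝ) ^ k * B l)).congr_of_eventuallyEq
    (Filter.Eventually.of_forall fun t => by ring)).congr_deriv ?_
  rcases Nat.eq_zero_or_pos (lam l) with h0 | hpos
  · rw [h0]; simp
  · have hxl : x ^ (lam l) = x ^ (lam l - 1) * x := by
      rw [← pow_succ, Nat.sub_add_cancel hpos]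
    rw [hxl]
    field_simp
    ring

/-- The stripped row through `H₀`: `A − Σ_l B_l x^{λ_l} = A − rowHK λ 0 B x`. [this file's lemma] -/
theorem row_eq_sub_rowHK_zero (x : ℝ) : A - ∑ l, B l * x ^ (lam l) = A - rowHK lam 0 B x := by
  unfold rowHK
  simp

/-- `d/dx u = H₁·u²/x` where the row does not vanish (`x ≠ 0`). [this file's lemma] -/
theorem hasDerivAt_rowUK {x : ℝ} (hx : x ≠ 0) (hF : A - ∑ l, B l * x ^ (lam l) ≠ 0) :
    HasDerivAt (rowUK lam A B) (rowHK lam 1 B x * rowUK lam A B x ^ 2 / x) x := by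
  have hH := hasDerivAt_rowHK lam B 0 hx
  have hF' : HasDerivAt (fun t : ℝ => A - ∑ l, B l * t ^ (lam l)) (0 - rowHK lam 1 B x / x) x := by
    have h := (hasDerivAt_const x A).sub hH
    refine h.congr_of_eventuallyEq (Filter.Eventually.of_forall fun t => ?_)
    simp only [Pi.sub_apply]
    rw [row_eq_sub_rowHK_zero]
  have hinv := hF'.inv hF
  unfold rowUK
  refine hinv.congr_deriv ?_
  field_simp
  ring

/-- `d/dx ψ₁ = ψ₂/x`. [this file's lemma] -/
theorem hasDerivAt_rowPsiK1 {x : ℝ} (hx : x ≠ 0) (hF : A - ∑ l, B l * x ^ (lam l) ≠ 0) :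
    HasDerivAt (rowPsiK1 lam A B) (rowPsiK2 lam A B x / x) x := by
  have hH1 := hasDerivAt_rowHK lam B 1 hx
  have hH2 := hasDerivAt_rowHK lam B 2 hx
  have hu := hasDerivAt_rowUK lam A B hx hF
  have h := (hH2.mul hu).add ((hH1.pow 2).mul (hu.pow 2))
  have hfun : rowPsiK1 lam A B = fun t => rowHK lam 2 B t * rowUK lam A B t + rowHK lam 1 B t ^ 2 * rowUK lam A B t ^ 2 := by
    funext t; rfl
  rw [hfun]
  refine h.congr_deriv ?_
  unfold rowPsiK2
  simp only [Pi.pow_apply]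
  push_cast
  field_simp
  ring

/-- `d/dx ψ₂ = ψ₃/x`. [this file's lemma] -/
theorem hasDerivAt_rowPsiK2 {x : ℝ} (hx : x ≠ 0) (hF : A - ∑ l, B l * x ^ (lam l) ≠ 0) :
    HasDerivAt (rowPsiK2 lam A B) (rowPsiK3 lam A B x / x) x := by
  have hH1 := hasDerivAt_rowHK lam B 1 hx
  have hH2 := hasDerivAt_rowHK lam B 2 hx
  have hH3 := hasDerivAt_rowHK lam B 3 hx
  have hu := hasDerivAt_rowUK lam A B hx hF
  have h := ((hH3.mul hu).add (((hH1.mul hH2).mul (hu.pow 2)).const_mul 3)).add (((hH1.pow 3).mul (hu.pow 3)).const_mul 2)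
  have hfun : rowPsiK2 lam A B = fun t => rowHK lam 3 B t * rowUK lam A B t + 3 * (rowHK lam 1 B t * rowHK lam 2 B t * rowUK lam A B t ^ 2)
      + 2 * (rowHK lam 1 B t ^ 3 * rowUK lam A B t ^ 3) := by
    funext t; unfold rowPsiK2; ring
  rw [hfun]
  refine h.congr_deriv ?_
  unfold rowPsiK3
  simp only [Pi.mul_apply, Pi.pow_apply]
  push_cast
  field_simp
  ring

/-! ### §2 Signs -/

/-- `H_k ≥ 0` for `B ≥ 0`, `x > 0`. [this file's lemma] -/
theorem rowHK_nonneg (k : ℕ) {x : ℝ} (hx : 0 < x) (hB : ∀ l, 0 ≤ B l) : 0 ≤ rowHK lam k B x := by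
  unfold rowHK
  exact Finset.sum_nonneg fun l _ => mul_nonneg (mul_nonneg (by positivity) (hB l)) (pow_pos hx _).le

/-- `u > 0` for an unswitched row. [this file's lemma] -/
theorem rowUK_pos {x : ℝ} (hF : 0 < A - ∑ l, B l * x ^ (lam l)) : 0 < rowUK lam A B x := by
  unfold rowUK; exact inv_pos.2 hF

/-! ### §3 The cloud law for every K -/

/-- The certificate `ψ₃ − p²ψ₁ = (H₄ − p²H₂)u + (3H₁H₃ + 3H₂² + H₁(H₃ − p²H₁))u² + 12H₁²H₂u³ + 6H₁⁴u⁴`. [this file's lemma] -/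
theorem rowPsiK3_sub_sq_mul_rowPsiK1_eq (p : ℝ) (x : ℝ) :
    rowPsiK3 lam A B x - p ^ 2 * rowPsiK1 lam A B x
      = (rowHK lam 4 B x - p ^ 2 * rowHK lam 2 B x) * rowUK lam A B x
        + (3 * rowHK lam 1 B x * rowHK lam 3 B x + 3 * rowHK lam 2 B x ^ 2
            + rowHK lam 1 B x * (rowHK lam 3 B x - p ^ 2 * rowHK lam 1 B x)) * rowUK lam A B x ^ 2
        + 12 * rowHK lam 1 B x ^ 2 * rowHK lam 2 B x * rowUK lam A B x ^ 3
        + 6 * rowHK lam 1 B x ^ 4 * rowUK lam A B x ^ 4 := by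
  unfold rowPsiK3 rowPsiK1
  ring

/-- `H_{k+2} − p²H_k = Σ_l λ_l^k(λ_l² − p²)·B_l x^{λ_l} ≥ 0` when every rate is `≥ p`, `B ≥ 0`, `x > 0`. [this file's lemma] -/
theorem rowHK_shift_nonneg (k p : ℕ) {x : ℝ} (hx : 0 < x) (hB : ∀ l, 0 ≤ B l) (hlam : ∀ l, p ≤ lam l) :
    0 ≤ rowHK lam (k + 2) B x - (p : ℝ) ^ 2 * rowHK lam k B x := by
  unfold rowHK
  rw [Finset.mul_sum, ← Finset.sum_sub_distrib]
  refine Finset.sum_nonneg fun l _ => ?_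
  have hterm : ((lam l : ℕ) : ℝ) ^ (k + 2) * B l * x ^ lam l - (p : ℝ) ^ 2 * (((lam l : ℕ) : ℝ) ^ k * B l * x ^ lam l)
      = ((lam l : ℕ) : ℝ) ^ k * ((((lam l : ℕ) : ℝ)) ^ 2 - (p : ℝ) ^ 2) * (B l * x ^ lam l) := by ring
  rw [hterm]
  have hlp : (p : ℝ) ≤ ((lam l : ℕ) : ℝ) := by exact_mod_cast hlam l
  have hsq : 0 ≤ (((lam l : ℕ) : ℝ)) ^ 2 - (p : ℝ) ^ 2 := by nlinarith [(Nat.cast_nonneg p : (0 : ℝ) ≤ p)]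
  exact mul_nonneg (mul_nonneg (by positivity) hsq) (mul_nonneg (hB l) (pow_pos hx _).le)

/-- ★ **THE CLOUD LAW for every K**: an unswitched row `A − Σ_l B_l x^{λ_l}` with `B ≥ 0`, all rates `λ_l ≥ p`, at `x > 0`, has `p²·ψ₁ ≤ ψ₃`. [this file's theorem] -/
theorem rowPsiK3_ge (p : ℕ) {x : ℝ} (hx : 0 < x) (hB : ∀ l, 0 ≤ B l) (hlam : ∀ l, p ≤ lam l)
    (hF : 0 < A - ∑ l, B l * x ^ (lam l)) :
    (p : ℝ) ^ 2 * rowPsiK1 lam A B x ≤ rowPsiK3 lam A B x := by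
  have hu := rowUK_pos lam A B hF
  have h1 := rowHK_nonneg lam B 1 hx hB
  have h2 := rowHK_nonneg lam B 2 hx hB
  have h3 := rowHK_nonneg lam B 3 hx hB
  have h42 := rowHK_shift_nonneg lam B 2 p hx hB hlam
  have h31 := rowHK_shift_nonneg lam B 1 p hx hB hlam
  rw [← sub_nonneg, rowPsiK3_sub_sq_mul_rowPsiK1_eq]
  have : rowHK lam (1 + 2) B x = rowHK lam 3 B x := by norm_num
  rw [this] at h31
  have : rowHK lam (2 + 2) B x = rowHK lam 4 B x := by norm_num
  rw [this] at h42
  positivity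

/-- ★ **THE CLOUD LAW, strict**: if moreover `H₁ > 0` (some letter `B_l x^{λ_l} > 0` with `λ_l ≥ 1`), then `p²·ψ₁ < ψ₃`. [this file's theorem] -/
theorem rowPsiK3_gt (p : ℕ) {x : ℝ} (hx : 0 < x) (hB : ∀ l, 0 ≤ B l) (hlam : ∀ l, p ≤ lam l)
    (hF : 0 < A - ∑ l, B l * x ^ (lam l)) (hH1 : 0 < rowHK lam 1 B x) :
    (p : ℝ) ^ 2 * rowPsiK1 lam A B x < rowPsiK3 lam A B x := by
  have hu := rowUK_pos lam A B hF
  have h2 := rowHK_nonneg lam B 2 hx hB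
  have h3 := rowHK_nonneg lam B 3 hx hB
  have h42 := rowHK_shift_nonneg lam B 2 p hx hB hlam
  have h31 := rowHK_shift_nonneg lam B 1 p hx hB hlam
  rw [← sub_pos, rowPsiK3_sub_sq_mul_rowPsiK1_eq]
  have : rowHK lam (1 + 2) B x = rowHK lam 3 B x := by norm_num
  rw [this] at h31
  have : rowHK lam (2 + 2) B x = rowHK lam 4 B x := by norm_num
  rw [this] at h42
  positivity

/-! ### §4 The one-letter rate law -/

/-- For a ONE-letter tail (`n = 1`, binomial row of rate `λ = lam 0`): `H_k = λ^k·(B₀x^λ)`. [this file's lemma] -/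
theorem rowHK_one (lam : Fin 1 → ℕ) (B : Fin 1 → ℝ) (k : ℕ) (x : ℝ) :
    rowHK lam k B x = ((lam 0 : ℕ) : ℝ) ^ k * (B 0 * x ^ (lam 0)) := by
  unfold rowHK
  rw [Fin.sum_univ_one]
  ring

/-- ★ **THE ONE-LETTER RATE LAW**: for a binomial row (`n = 1`, rate `λ`), `ψ₃ − λ²ψ₁ = 6ψ₁²` (pure identity, any signs). [this file's theorem] -/
theorem rowPsiK3_one_letter_law (lam : Fin 1 → ℕ) (A : ℝ) (B : Fin 1 → ℝ) (x : ℝ) :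
    rowPsiK3 lam A B x - ((lam 0 : ℕ) : ℝ) ^ 2 * rowPsiK1 lam A B x = 6 * rowPsiK1 lam A B x ^ 2 := by
  unfold rowPsiK3 rowPsiK1
  simp only [rowHK_one]
  ring

/-- The one-letter closed form: `ψ₁ = λ²·A·(B₀x^λ)·u²` where the row does not vanish. [this file's lemma] -/
theorem rowPsiK1_one_letter_eq (lam : Fin 1 → ℕ) (A : ℝ) (B : Fin 1 → ℝ) {x : ℝ} (hF : A - ∑ l, B l * x ^ (lam l) ≠ 0) :
    rowPsiK1 lam A B x = ((lam 0 : ℕ) : ℝ) ^ 2 * (A * (B 0 * x ^ (lam 0))) * rowUK lam A B x ^ 2 := by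
  have hF1 : A - B 0 * x ^ (lam 0) ≠ 0 := by rwa [Fin.sum_univ_one] at hF
  unfold rowPsiK1 rowUK
  simp only [rowHK_one, Fin.sum_univ_one]
  field_simp
  ring

/-! ### §5 Single-letter tails inside a larger support (binomial rows of a K-nomial company) -/

/-- If the tail is supported on ONE index `l₀` then `H_k = λ_{l₀}^k·(B_{l₀}x^{λ_{l₀}})`. [this file's lemma] -/
theorem rowHK_single (l₀ : Fin n) (hB : ∀ l, l ≠ l₀ → B l = 0) (k : ℕ) (x : ℝ) :
    rowHK lam k B x = ((lam l₀ : ℕ) : ℝ) ^ k * (B l₀ * x ^ (lam l₀)) := by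
  unfold rowHK
  rw [Finset.sum_eq_single l₀ (fun l _ hl => by rw [hB l hl]; ring) (fun h => absurd (Finset.mem_univ _) h)]
  ring

/-- The stripped row with a single tail letter: `A − Σ_l B_l x^{λ_l} = A − B_{l₀}x^{λ_{l₀}}`. [this file's lemma] -/
theorem row_single (l₀ : Fin n) (hB : ∀ l, l ≠ l₀ → B l = 0) (x : ℝ) :
    A - ∑ l, B l * x ^ (lam l) = A - B l₀ * x ^ (lam l₀) := by
  rw [Finset.sum_eq_single l₀ (fun l _ hl => by rw [hB l hl]; ring) (fun h => absurd (Finset.mem_univ _) h)]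

/-- ★ **THE SINGLE-LETTER RATE LAW inside any support**: `ψ₃ − λ_{l₀}²ψ₁ = 6ψ₁²`. [this file's theorem] -/
theorem rowPsiK3_single_law (l₀ : Fin n) (hB : ∀ l, l ≠ l₀ → B l = 0) (x : ℝ) :
    rowPsiK3 lam A B x - ((lam l₀ : ℕ) : ℝ) ^ 2 * rowPsiK1 lam A B x = 6 * rowPsiK1 lam A B x ^ 2 := by
  unfold rowPsiK3 rowPsiK1
  simp only [rowHK_single lam B l₀ hB]
  ring

/-- The single-letter closed form: `ψ₁ = λ_{l₀}²·A·(B_{l₀}x^{λ_{l₀}})·u²` where the row does not vanish. [this file's lemma] -/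
theorem rowPsiK1_single_eq (l₀ : Fin n) (hB : ∀ l, l ≠ l₀ → B l = 0) {x : ℝ} (hF : A - ∑ l, B l * x ^ (lam l) ≠ 0) :
    rowPsiK1 lam A B x = ((lam l₀ : ℕ) : ℝ) ^ 2 * (A * (B l₀ * x ^ (lam l₀))) * rowUK lam A B x ^ 2 := by
  have hF1 : A - B l₀ * x ^ (lam l₀) ≠ 0 := by rwa [row_single lam A B l₀ hB] at hF
  unfold rowPsiK1 rowUK
  simp only [rowHK_single lam B l₀ hB, row_single lam A B l₀ hB]
  field_simp
  ring

/-- A POLE (`A·B_{l₀} > 0`) has `ψ₁ > 0`; a KNEE (`A·B_{l₀} < 0`) has `ψ₁ < 0` (`x > 0`, row non-vanishing). [this file's lemma] -/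
theorem rowPsiK1_single_pos (l₀ : Fin n) (hB : ∀ l, l ≠ l₀ → B l = 0) {x : ℝ} (hx : 0 < x) (hl : lam l₀ ≠ 0)
    (hAB : 0 < A * B l₀) (hF : A - ∑ l, B l * x ^ (lam l) ≠ 0) : 0 < rowPsiK1 lam A B x := by
  rw [rowPsiK1_single_eq lam A B l₀ hB hF]
  have hU : rowUK lam A B x ≠ 0 := by unfold rowUK; exact inv_ne_zero hF
  have hl' : (0 : ℝ) < ((lam l₀ : ℕ) : ℝ) := by exact_mod_cast Nat.pos_of_ne_zero hl
  have h1 : 0 < A * (B l₀ * x ^ (lam l₀)) := by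
    have : A * (B l₀ * x ^ (lam l₀)) = (A * B l₀) * x ^ (lam l₀) := by ring
    rw [this]; exact mul_pos hAB (pow_pos hx _)
  positivity

/-- (knee sign) `A·B_{l₀} < 0 ⇒ ψ₁ < 0`. [this file's lemma] -/
theorem rowPsiK1_single_neg (l₀ : Fin n) (hB : ∀ l, l ≠ l₀ → B l = 0) {x : ℝ} (hx : 0 < x) (hl : lam l₀ ≠ 0)
    (hAB : A * B l₀ < 0) (hF : A - ∑ l, B l * x ^ (lam l) ≠ 0) : rowPsiK1 lam A B x < 0 := by
  rw [rowPsiK1_single_eq lam A B l₀ hB hF]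
  have hU : rowUK lam A B x ≠ 0 := by unfold rowUK; exact inv_ne_zero hF
  have hU2 : 0 < rowUK lam A B x ^ 2 := by positivity
  have hl' : (0 : ℝ) < ((lam l₀ : ℕ) : ℝ) := by exact_mod_cast Nat.pos_of_ne_zero hl
  have h1 : A * (B l₀ * x ^ (lam l₀)) < 0 := by
    have : A * (B l₀ * x ^ (lam l₀)) = (A * B l₀) * x ^ (lam l₀) := by ring
    rw [this]; exact mul_neg_of_neg_of_pos hAB (pow_pos hx _)
  have : ((lam l₀ : ℕ) : ℝ) ^ 2 * (A * (B l₀ * x ^ (lam l₀))) < 0 := mul_neg_of_pos_of_neg (by positivity) h1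
  exact mul_neg_of_neg_of_pos this hU2

end ProductPlusOne

end Summit.ValiantsHypothesis.ValiantsHypothesis.Theorems.LacunarySymmetroidMatrixDescartes
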